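import Literature.RepresentationTheory.FiniteGroups.SymmetricGroupPowerSumCycles
import Literature.RepresentationTheory.FiniteGroups.SymmetricGroupFrobeniusFormula
import Literature.NumberTheory.DiophantineGeometry.PartitionTableauxProofs
import HarnessLib

/-!
# Frobenius's formula at the identity: `[x^{λ+ρ}] (a_ρ · p_1^f) = f^λ`, and coefficient rules

Topic `Literature/RepresentationTheory/FiniteGroups`. Three ingredients of the evaluation of the
characters of `𝔖_f` by the Murnaghan–Nakayama recursion on exponent vectors
(`SymmetricGroupCharacterEvaluation.lean`), all for the antisymmetric polynomials
`G = (∏ p_m) · a_ρ · p_1^f ∈ ℤ[x_1, …, x_N]` of Frobenius's formula: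

* `coeff_eq_zero_of_antisymm_of_apply_eq`: if `rename g G = sign(g) G` for the transposition
  `g = (i j)` and the exponent vector `α` has `α_i = α_j`, then `[x^α] G = 0`.
* `frobeniusChar_one_eq_numStandardTableaux`: **Frobenius's formula at `σ = 1` computes the
  degree**: `[x^{λ+ρ}] (a_ρ · p_1^f) = f^λ = #SYT(λ)` (`χ^λ(1) = dim S^λ = f^λ`;
  Fulton–Harris
  (4.11) is the resulting closed formula).
* `coeff_alternant_mul_psum_one_pow_mul_prod_factorial`: the closed **degree formula in
  `β`-numbers** `[x^{l}] (a_ρ · p_1^f) · ∏_i l_i! = f! · ∏_{i<s} (l_i - l_s)`,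
  `l = λ + ρ`
  (Frame–Robinson–Thrall / Fulton–Harris (4.11)), by the tree's hook-length identity
  `card_stdFilling_mul_prod_factorial`.

These let the recursion stop as soon as all non-trivial cycles are peeled: the remaining factor
`p_1^f` (one `p_1` per fixed point) is evaluated in closed form instead of by `f` further steps.

## References

* W. Fulton, J. Harris, *Representation Theory. A First Course*, GTM 129 (1991), Thm. 4.10 and
  formula (4.11) (`dim V_λ = f!/(l_1! ⋯ l_k!) · ∏_{i<j} (l_i - l_j)`). [FultonHarrisGTM129]
* J. S. Frame, G. de B. Robinson, R. M. Thrall, Canad. J. Math. 6 (1954), Thm. 1, (2.2).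
  [FrameRobinsonThrallCJM1954]

## Mathlib and tree

Mathlib: `Representation.char_one`, `Finsupp.mapDomain_equiv_apply`, `Equiv.swap`,
`Equiv.Perm.sign_swap`. Tree: `spechtCharacter_eq_frobeniusChar`, `frobeniusChar_def`,
`fixedWordPoly_one` (`SymmetricGroupPowerSumCycles.lean`), `coeff_mapDomain_of_rename_eq`,
`finrank_spechtIdeal_holds`, `numStandardTableaux_eq_card_stdFilling`,
`card_stdFilling_mul_prod_factorial`, `rowLen_youngDiagram`, `fst_lt_of_mem_youngDiagram`,
`Nat.Partition.card_cells_youngDiagram`.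
-/

noncomputable section

open scoped BigOperators
open MvPolynomial Finset
open Literature.RingTheory.SymmetricFunctions.SymmPoly (alternant rho rho_apply)
open Literature.NumberTheory.DiophantineGeometry (spechtCharacter spechtIdeal numStandardTableaux
  finrank_spechtIdeal_holds numStandardTableaux_eq_card_stdFilling StdFilling
  card_stdFilling_mul_prod_factorial rowLen_youngDiagram fst_lt_of_mem_youngDiagram)

namespace Literature.RepresentationTheory.FiniteGroups

/-! ### Coefficients of antisymmetric polynomials at exponent vectors with a repetition -/

section Antisymmetric

variable {N : ℕ}

/-- A transposition fixes an exponent vector taking equal values at the two letters. [folklore] -/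
theorem mapDomain_swap_of_apply_eq {α : Fin N →₀ ℕ} {i j : Fin N} (h : α i = α j) :
    Finsupp.mapDomain (Equiv.swap i j) α = α := by
  ext a
  rw [Finsupp.mapDomain_equiv_apply, Equiv.symm_swap]
  rcases eq_or_ne a i with rfl | hai
  · rw [Equiv.swap_apply_left, h]
  · rcases eq_or_ne a j with rfl | haj
    · rw [Equiv.swap_apply_right, h]
    · rw [Equiv.swap_apply_of_ne_of_ne hai haj]

/-- **Antisymmetric polynomials have no monomials with a repeated exponent**: if
`rename (i j) G = sign((i j)) · G` for a transposition `(i j)`, `i ≠ j`, and `α_i = α_j`, then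
`[x^α] G = 0` (the transposition fixes `x^α` and changes the sign of `G`). [folklore] -/
theorem coeff_eq_zero_of_antisymm_of_apply_eq {G : MvPolynomial (Fin N) ℤ} {i j : Fin N}
    (hij : i ≠ j)
    (hG : rename (Equiv.swap i j) G =
      ((Equiv.Perm.sign (Equiv.swap i j) : ℤ) : MvPolynomial (Fin N) ℤ) * G)
    {α : Fin N →₀ ℕ} (h : α i = α j) : coeff α G = 0 := by
  have h1 := coeff_mapDomain_of_rename_eq hG α
  rw [mapDomain_swap_of_apply_eq h, Equiv.Perm.sign_swap hij, Units.val_neg, Units.val_one] at h1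
  omega

/-- The polynomials `(∏_{m ∈ ms} p_m) · (a_ρ · p_1^f)` of Frobenius's formula are
antisymmetric.
[folklore] -/
theorem rename_prod_psum_mul_alternant_mul_pow (ms : List ℕ) (f : ℕ) (g : Equiv.Perm (Fin N)) :
    rename g ((ms.map (psum (Fin N) ℤ)).prod *
        (alternant (fun i => (X i : MvPolynomial (Fin N) ℤ)) (rho N) * psum (Fin N) ℤ 1 ^ f)) =
      ((Equiv.Perm.sign g : ℤ) : MvPolynomial (Fin N) ℤ) *
        ((ms.map (psum (Fin N) ℤ)).prod *
          (alternant (fun i => (X i : MvPolynomial (Fin N) ℤ)) (rho N) *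
            psum (Fin N) ℤ 1 ^ f)) := by
  refine rename_prod_psum_mul ms ?_
  rw [map_mul, map_pow, rename_psum, rename_alternant_X, mul_assoc]

end Antisymmetric

/-! ### Frobenius's formula at the identity -/

section Degree

variable {N f : ℕ}

/-- **Frobenius's formula at `σ = 1` computes the degree**: for a partition `λ ⊢ f` with at most
`N` parts, `[x^{λ+ρ}] (a_ρ(x) · (x_1 + ⋯ + x_N)^f) = f^λ`, the number of standard Young
tableaux of shape `λ` (`= χ^λ(1) = dim S^λ`).
[cite: FultonHarrisGTM129, Theorem 4.10 with (4.11)] -/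
theorem frobeniusChar_one_eq_numStandardTableaux (lam : Nat.Partition f)
    (hN : lam.parts.card ≤ N) :
    frobeniusChar N (fun i : Fin N => lam.sortedParts.getD i 0) (1 : Equiv.Perm (Fin f)) =
      numStandardTableaux lam := by
  have h1 := spechtCharacter_eq_frobeniusChar lam hN (1 : Equiv.Perm (Fin f))
  have h2 : spechtCharacter ℂ lam 1 = (numStandardTableaux lam : ℂ) := by
    rw [spechtCharacter, Representation.char_one, finrank_spechtIdeal_holds ℂ lam]
  rw [h2] at h1
  exact_mod_cast h1.symm

/-- **The coefficient `[x^{λ+ρ}] (a_ρ · p_1^f)` is `f^λ`** (Frobenius's formula at `1` with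
`F_1 = p_1^f`). [cite: FultonHarrisGTM129, Theorem 4.10 with (4.11)] -/
theorem coeff_alternant_mul_psum_one_pow (lam : Nat.Partition f) (hN : lam.parts.card ≤ N) :
    coeff (Finsupp.equivFunOnFinite.symm ((fun i : Fin N => lam.sortedParts.getD i 0) + rho N))
        (alternant (fun i => (X i : MvPolynomial (Fin N) ℤ)) (rho N) * psum (Fin N) ℤ 1 ^ f) =
      numStandardTableaux lam := by
  rw [← frobeniusChar_one_eq_numStandardTableaux lam hN, frobeniusChar_def, fixedWordPoly_one,
    Fintype.card_fin]

/-- **The degree formula in `β`-numbers** (Frame–Robinson–Thrall (2.2); Fulton–Harris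
(4.11)):
with `l_i = λ_i + (N - 1 - i)`,
`[x^{l}] (a_ρ · p_1^f) · ∏_{i<N} l_i! = f! · ∏_{i<s<N} (l_i - l_s)` (an identity in `ℚ`).
[cite: FultonHarrisGTM129, (4.11)] -/
theorem coeff_alternant_mul_psum_one_pow_mul_prod_factorial (lam : Nat.Partition f)
    (hN : lam.parts.card ≤ N) :
    ((coeff (Finsupp.equivFunOnFinite.symm ((fun i : Fin N => lam.sortedParts.getD i 0) + rho N))
        (alternant (fun i => (X i : MvPolynomial (Fin N) ℤ)) (rho N) *
          psum (Fin N) ℤ 1 ^ f) : ℤ) : ℚ) *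
        ∏ i ∈ range N, ((lam.sortedParts.getD i 0 + (N - 1 - i)).factorial : ℚ) =
      (f.factorial : ℚ) * ∏ i ∈ range N, ∏ s ∈ Ioo i N,
        (((lam.sortedParts.getD i 0 + (N - 1 - i) : ℕ) : ℚ) -
          ((lam.sortedParts.getD s 0 + (N - 1 - s) : ℕ) : ℚ)) := by
  rw [coeff_alternant_mul_psum_one_pow lam hN, Int.cast_natCast,
    numStandardTableaux_eq_card_stdFilling]
  have h := card_stdFilling_mul_prod_factorial N f lam.youngDiagram lam.card_cells_youngDiagram
    (fun c hc => fst_lt_of_mem_youngDiagram lam hN hc)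
  simp only [rowLen_youngDiagram] at h
  exact h

end Degree

end Literature.RepresentationTheory.FiniteGroups

end
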